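import Literature.AnabelianGeometry.SemiGraphs.ProSigmaCompletionExtend
import Mathlib.Topology.Algebra.ClopenNhdofOne
import Mathlib.Topology.Maps.Proper.Basic
import HarnessLib

/-!
# Pro-`Σ` completions, III: the universal property for PROFINITE pro-`Σ` targets

Continuation of `ProSigmaCompletionExtend.lean` over abc-iut-L3-t1's interface
`SemiGraphOfAnabelioids.IsProSigmaCompletion Sigma ι` ([SemiAnbd] Example 2.10, "the maximal pro-`Σ`
quotient", p. 31) [cite: MochizukiSemiAnbd2006, Ex. 2.10 p.31].  Part II proved that a homomorphism
`f : Γ → Q` to a FINITE group of `Σ`-integer order extends continuously along `ι : Γ → P`; here the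
target is any PROFINITE pro-`Σ` group `B` (compact, totally disconnected, every open normal subgroup of
`Σ`-integer index) — the form in which "free of rank `r` over `Ẑ^Σ`" is USED in [CombGC] Rmk. 1.1.4 /
1.3.1 (sections of extensions by free pro-`Σ` modules; sub-DAG row CombGC:Thm1.6/T16-L08):

* `exists_continuous_extend_profinite`: `∃ F : P →* B` continuous with `F ∘ ι = f`;
* `continuous_extend_profinite_unique`: such an `F` is unique (`B` Hausdorff, `ι(Γ)` dense).

Proof (closed-graph construction, no inverse limits): the closure `S` in `P × B` of the graph subgroup
`{(ι γ, f γ)}` is a subgroup; for an open normal `V ⊴ B` the pull-back `f⁻¹(V)` is normal of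
`Σ`-integer index, so by universality `f⁻¹(V) = ι⁻¹(W)` for an open `W ≤ P`, whence the graph — and
therefore its closure — lies in the clopen set `(W × V) ∪ (Wᶜ × Vᶜ)`; as the `V` separate the points
of `B` this makes `S` the graph of a function `s` (`s(W) ⊆ V` gives continuity), defined on all of `P`
because the first projection is a closed map (`B` compact) with dense image.  Plain profinite group
theory; no statement of the papers is restated; nothing here takes a side on [IUTchIII] Cor. 3.12.
-/

namespace Literature.AnabelianGeometry.SemiGraphs.SemiGraphOfAnabelioids.IsProSigmaCompletion

open Literature.AnabelianGeometry.Anabelioids Topology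

variable {Sigma : Set ℕ} {Γ : Type*} [Group Γ] {P : Type*} [Group P] {B : Type*} [Group B]

/-! ### The graph subgroup -/

/-! The graph of `f` along `ι` is the subgroup `(ι.prod f).range = {(ι γ, f γ) | γ ∈ Γ}` of
`P × B`; its closure `(ι.prod f).range.topologicalClosure` is the object of this file (kept inline,
no new definitions). -/

/-- `(ι γ, f γ)` lies on the graph. [cite: MochizukiSemiAnbd2006, Ex. 2.10 p.31] -/
theorem mk_mem_graphSubgroup (ι : Γ →* P) (f : Γ →* B) (γ : Γ) :
    (ι γ, f γ) ∈ (ι.prod f).range :=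
  ⟨γ, rfl⟩

/-- If `ι⁻¹(W) = f⁻¹(V)`, the graph lies in the set `{(p, b) | p ∈ W ↔ b ∈ V}`.
[cite: MochizukiSemiAnbd2006, Ex. 2.10 p.31] -/
theorem graphSubgroup_le_setOf_iff (ι : Γ →* P) (f : Γ →* B) {W : Subgroup P} {V : Subgroup B}
    (hWV : W.comap ι = V.comap f) :
    ((ι.prod f).range : Set (P × B)) ⊆ {x | x.1 ∈ W ↔ x.2 ∈ V} := by
  rintro _ ⟨γ, rfl⟩
  change ι γ ∈ W ↔ f γ ∈ V
  rw [← Subgroup.mem_comap, hWV, Subgroup.mem_comap]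

/-- Universality at a normal `V ⊴ B` of `Σ`-integer index: `f⁻¹(V) = ι⁻¹(W)` for some open subgroup
`W ≤ P` (the index of `f⁻¹(V)` divides that of `V`). [cite: MochizukiSemiAnbd2006, Ex. 2.10 p.31] -/
theorem exists_isOpen_comap_eq_comap [TopologicalSpace P] {ι : Γ →* P}
    (hι : IsProSigmaCompletion Sigma ι) (f : Γ →* B) (V : Subgroup B) [V.Normal]
    (hV : IsSigmaInteger Sigma V.index) :
    ∃ W : Subgroup P, IsOpen (W : Set P) ∧ W.comap ι = V.comap f := by
  haveI : (V.comap f).Normal := Subgroup.Normal.comap inferInstance f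
  have hidx : IsSigmaInteger Sigma (V.comap f).index := by
    rw [Subgroup.index_comap]
    exact hV.of_dvd (Subgroup.relIndex_dvd_index_of_normal (H := V) (K := f.range))
  exact hι.comap_surj (V.comap f) inferInstance hidx

/-- For clopen `W ⊆ P`, `V ⊆ B` the set `{(p, b) | p ∈ W ↔ b ∈ V} = (W × V) ∪ (Wᶜ × Vᶜ)` is closed.
[folklore] -/
private theorem isClosed_setOf_iff {X Y : Type*} [TopologicalSpace X] [TopologicalSpace Y] {W : Set X}
    {V : Set Y} (hW : IsClopen W) (hV : IsClopen V) :
    IsClosed {x : X × Y | x.1 ∈ W ↔ x.2 ∈ V} := by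
  have h : {x : X × Y | x.1 ∈ W ↔ x.2 ∈ V} =
      (Prod.fst ⁻¹' W ∩ Prod.snd ⁻¹' V) ∪ (Prod.fst ⁻¹' Wᶜ ∩ Prod.snd ⁻¹' Vᶜ) := by
    ext x
    simp only [Set.mem_setOf_eq, Set.mem_union, Set.mem_inter_iff, Set.mem_preimage,
      Set.mem_compl_iff]
    tauto
  rw [h]
  exact ((hW.isClosed.preimage continuous_fst).inter (hV.isClosed.preimage continuous_snd)).union
    ((hW.compl.isClosed.preimage continuous_fst).inter (hV.compl.isClosed.preimage continuous_snd))

section Closure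

variable [TopologicalSpace P] [IsTopologicalGroup P] [TopologicalSpace B] [IsTopologicalGroup B]

/-- `(ι γ, f γ)` lies in the closure of the graph. [cite: MochizukiSemiAnbd2006, Ex. 2.10 p.31] -/
theorem mk_mem_graphClosure (ι : Γ →* P) (f : Γ →* B) (γ : Γ) :
    (ι γ, f γ) ∈ (ι.prod f).range.topologicalClosure :=
  Subgroup.le_topologicalClosure _ (mk_mem_graphSubgroup ι f γ)

/-- The closure of the graph is closed. [cite: MochizukiSemiAnbd2006, Ex. 2.10 p.31] -/
theorem isClosed_graphClosure (ι : Γ →* P) (f : Γ →* B) :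
    IsClosed ((ι.prod f).range.topologicalClosure : Set (P × B)) :=
  Subgroup.isClosed_topologicalClosure _

/-- If `ι⁻¹(W) = f⁻¹(V)` with `W`, `V` OPEN subgroups, the closure of the graph still lies in
`{(p, b) | p ∈ W ↔ b ∈ V}` (open subgroups are clopen). [cite: MochizukiSemiAnbd2006, Ex. 2.10 p.31] -/
theorem fst_mem_iff_snd_mem_of_mem_graphClosure (ι : Γ →* P) (f : Γ →* B) {W : Subgroup P}
    {V : Subgroup B} (hW : IsOpen (W : Set P)) (hVo : IsOpen (V : Set B))
    (hWV : W.comap ι = V.comap f) {x : P × B}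
    (hx : x ∈ (ι.prod f).range.topologicalClosure) : x.1 ∈ W ↔ x.2 ∈ V := by
  have hWc : IsClopen (W : Set P) := ⟨Subgroup.isClosed_of_isOpen W hW, hW⟩
  have hVc : IsClopen (V : Set B) := ⟨Subgroup.isClosed_of_isOpen V hVo, hVo⟩
  have hsub : ((ι.prod f).range.topologicalClosure : Set (P × B)) ⊆ {x | x.1 ∈ W ↔ x.2 ∈ V} := by
    change closure ((ι.prod f).range : Set (P × B)) ⊆ _
    exact closure_minimal (graphSubgroup_le_setOf_iff ι f hWV) (isClosed_setOf_iff hWc hVc)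
  exact hsub hx

/-! ### The closure of the graph is the graph of a continuous homomorphism -/

variable [CompactSpace B] {ι : Γ →* P}

/-- **Totality.**  Every `p ∈ P` has a companion `b` with `(p, b)` in the closure of the graph: the
first projection `P × B → P` is a closed map (`B` compact) and its image contains the dense set
`ι(Γ)`. [cite: MochizukiSemiAnbd2006, Ex. 2.10 p.31] -/
theorem exists_mem_graphClosure (hι : IsProSigmaCompletion Sigma ι) (f : Γ →* B) (p : P) :
    ∃ b : B, (p, b) ∈ (ι.prod f).range.topologicalClosure := by
  have hclosed : IsClosed (Prod.fst '' ((ι.prod f).range.topologicalClosure : Set (P × B))) :=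
    isClosedMap_fst_of_compactSpace _ (isClosed_graphClosure ι f)
  have hdense : Set.range ι ⊆ Prod.fst '' ((ι.prod f).range.topologicalClosure : Set (P × B)) := by
    rintro _ ⟨γ, rfl⟩
    exact ⟨(ι γ, f γ), mk_mem_graphClosure ι f γ, rfl⟩
  have huniv : Prod.fst '' ((ι.prod f).range.topologicalClosure : Set (P × B)) = Set.univ := by
    apply Set.eq_univ_of_univ_subset
    rw [← hι.dense.closure_eq]
    exact closure_minimal hdense hclosed
  have hp : p ∈ Prod.fst '' ((ι.prod f).range.topologicalClosure : Set (P × B)) := by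
    rw [huniv]; trivial
  obtain ⟨x, hmem, hx⟩ := hp
  refine ⟨x.2, ?_⟩
  have : x = (p, x.2) := Prod.ext hx rfl
  rwa [this] at hmem

variable [TotallyDisconnectedSpace B]

/-- **Functionality.**  If `B` is pro-`Σ`, an element `(1, b)` of the closure of the graph has `b = 1`
(the open normal subgroups of the profinite group `B` separate points).
[cite: MochizukiSemiAnbd2006, Ex. 2.10 p.31] -/
theorem eq_one_of_one_mem_graphClosure (hι : IsProSigmaCompletion Sigma ι)
    (hB : ∀ V : Subgroup B, V.Normal → IsOpen (V : Set B) → IsSigmaInteger Sigma V.index)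
    (f : Γ →* B) {b : B} (hb : ((1 : P), b) ∈ (ι.prod f).range.topologicalClosure) : b = 1 := by
  by_contra hne
  -- an open normal subgroup of `B` missing `b`
  have h1 : (1 : B) ∈ ({b}ᶜ : Set B) := by
    rw [Set.mem_compl_singleton_iff]
    exact fun h => hne h.symm
  obtain ⟨V, hV⟩ := ProfiniteGrp.exist_openNormalSubgroup_sub_open_nhds_of_one
    (isOpen_compl_singleton (x := b)) h1
  have hbV : b ∉ ((V : Subgroup B) : Set B) := fun h =>
    (Set.mem_compl_singleton_iff.mp (hV h)) rfl
  haveI : (V : Subgroup B).Normal := V.isNormal'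
  obtain ⟨W, hWo, hWV⟩ :=
    exists_isOpen_comap_eq_comap hι f (V : Subgroup B) (hB _ V.isNormal' V.isOpen')
  have key : (1 : P) ∈ W ↔ b ∈ (V : Subgroup B) :=
    fst_mem_iff_snd_mem_of_mem_graphClosure ι f hWo V.isOpen' hWV hb
  exact hbV (key.mp W.one_mem)

/-- The companion is unique. [cite: MochizukiSemiAnbd2006, Ex. 2.10 p.31] -/
theorem graphClosure_functional (hι : IsProSigmaCompletion Sigma ι)
    (hB : ∀ V : Subgroup B, V.Normal → IsOpen (V : Set B) → IsSigmaInteger Sigma V.index)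
    (f : Γ →* B) {p : P} {b b' : B} (hb : (p, b) ∈ (ι.prod f).range.topologicalClosure)
    (hb' : (p, b') ∈ (ι.prod f).range.topologicalClosure) : b = b' := by
  have h : ((p, b)⁻¹ * (p, b') : P × B) ∈ (ι.prod f).range.topologicalClosure :=
    ((ι.prod f).range.topologicalClosure).mul_mem (((ι.prod f).range.topologicalClosure).inv_mem hb) hb'
  have h1 : ((1 : P), b⁻¹ * b') ∈ (ι.prod f).range.topologicalClosure := by
    have e : ((p, b)⁻¹ * (p, b') : P × B) = ((1 : P), b⁻¹ * b') := by
      ext <;> simp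
    rwa [e] at h
  have := eq_one_of_one_mem_graphClosure hι hB f h1
  rwa [inv_mul_eq_one] at this

/-- **The universal property of a pro-`Σ` completion for profinite pro-`Σ` targets.**  Let
`ι : Γ → P` be a pro-`Σ` completion (`P` any topological group) and `B` a profinite group all of
whose open normal subgroups have `Σ`-integer index.  Then every homomorphism `f : Γ → B` extends to a
CONTINUOUS homomorphism `F : P → B` with `F ∘ ι = f`.  (For finite `B` this is
`exists_continuous_extend_top`.) [cite: MochizukiSemiAnbd2006, Ex. 2.10 p.31] -/
theorem exists_continuous_extend_profinite (hι : IsProSigmaCompletion Sigma ι)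
    (hB : ∀ V : Subgroup B, V.Normal → IsOpen (V : Set B) → IsSigmaInteger Sigma V.index)
    (f : Γ →* B) : ∃ F : P →* B, Continuous F ∧ ∀ γ, F (ι γ) = f γ := by
  classical
  -- the function whose graph is the closure of the graph subgroup
  choose s hs using exists_mem_graphClosure hι f
  have hgraph : ∀ {p : P} {b : B}, (p, b) ∈ (ι.prod f).range.topologicalClosure → s p = b :=
    fun {p} {b} h => graphClosure_functional hι hB f (hs p) h
  have hone : s 1 = 1 := hgraph ((ι.prod f).range.topologicalClosure).one_mem
  have hmul : ∀ p q, s (p * q) = s p * s q := fun p q => by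
    apply hgraph
    have hpq := ((ι.prod f).range.topologicalClosure).mul_mem (hs p) (hs q)
    rwa [Prod.mk_mul_mk] at hpq
  let F : P →* B := { toFun := s, map_one' := hone, map_mul' := hmul }
  have hFι : ∀ γ, F (ι γ) = f γ := fun γ => hgraph (mk_mem_graphClosure ι f γ)
  refine ⟨F, ?_, hFι⟩
  -- continuity at `1`: `F(W) ⊆ V` whenever `ι⁻¹(W) = f⁻¹(V)`
  apply continuous_of_continuousAt_one F
  rw [ContinuousAt, map_one]
  intro U hU
  obtain ⟨V, hV⟩ := ProfiniteGrp.exist_openNormalSubgroup_sub_open_nhds_of_one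
    (isOpen_interior (s := U)) (mem_interior_iff_mem_nhds.mpr hU)
  haveI : (V : Subgroup B).Normal := V.isNormal'
  obtain ⟨W, hWo, hWV⟩ :=
    exists_isOpen_comap_eq_comap hι f (V : Subgroup B) (hB _ V.isNormal' V.isOpen')
  refine Filter.mem_map.mpr (Filter.mem_of_superset (hWo.mem_nhds W.one_mem) fun p hp => ?_)
  have hpV : s p ∈ (V : Subgroup B) :=
    (fst_mem_iff_snd_mem_of_mem_graphClosure ι f hWo V.isOpen' hWV (hs p)).mp hp
  exact (interior_subset (hV hpV) : F p ∈ U)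

end Closure

/-- **Uniqueness** of the continuous extension (`B` Hausdorff; `ι(Γ)` is dense).
[cite: MochizukiSemiAnbd2006, Ex. 2.10 p.31] -/
theorem continuous_extend_profinite_unique [TopologicalSpace P] [TopologicalSpace B] [T2Space B]
    {ι : Γ →* P} (hι : IsProSigmaCompletion Sigma ι) {F F' : P →* B} (hF : Continuous F)
    (hF' : Continuous F') (h : ∀ γ, F (ι γ) = F' (ι γ)) : F = F' := by
  have key : (F : P → B) = F' :=
    Continuous.ext_on hι.dense hF hF' (by rintro _ ⟨γ, rfl⟩; exact h γ)
  exact DFunLike.coe_injective key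


/-! ### Functoriality and uniqueness of the pro-`Σ` completion (appended, abc-iut-w5-d183) -/

section Canonical

variable {Γ' : Type*} [Group Γ'] {P' : Type*} [Group P'] [TopologicalSpace P'] [IsTopologicalGroup P']
  [CompactSpace P'] [TotallyDisconnectedSpace P'] {ι' : Γ' →* P'}

/-- **Functoriality of the pro-`Σ` completion.**  A homomorphism `φ : Γ → Γ'` extends to a continuous
homomorphism `F : P → P'` of pro-`Σ` completions (`P'` profinite) with `F ∘ ι = ι' ∘ φ`; the target's
`Σ`-integrality of open-normal indices is part of `IsProSigmaCompletion`.
[cite: MochizukiSemiAnbd2006, Ex. 2.10 p.31] -/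
theorem exists_continuous_map [TopologicalSpace P] [IsTopologicalGroup P] {ι : Γ →* P}
    (hι : IsProSigmaCompletion Sigma ι) (hι' : IsProSigmaCompletion Sigma ι') (φ : Γ →* Γ') :
    ∃ F : P →* P', Continuous F ∧ ∀ γ, F (ι γ) = ι' (φ γ) := by
  obtain ⟨F, hF, hFι⟩ := exists_continuous_extend_profinite hι hι'.index_open (ι'.comp φ)
  exact ⟨F, hF, fun γ => hFι γ⟩

variable [TopologicalSpace P] [IsTopologicalGroup P] [CompactSpace P] [TotallyDisconnectedSpace P]
  {ι : Γ →* P}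

/-- **The pro-`Σ` completion is unique up to isomorphism.**  Two pro-`Σ` completions `ι : Γ → P`,
`κ : Γ → P'` of the same group (`P`, `P'` profinite) are related by an isomorphism of topological
groups `e : P ≅ P'` with `e ∘ ι = κ` (the two continuous extensions compose to the identity by
uniqueness of extensions). [cite: MochizukiSemiAnbd2006, Ex. 2.10 p.31] -/
theorem exists_continuousMulEquiv (hι : IsProSigmaCompletion Sigma ι) {κ : Γ →* P'}
    (hκ : IsProSigmaCompletion Sigma κ) : ∃ e : P ≃ₜ* P', ∀ γ, e (ι γ) = κ γ := by
  obtain ⟨F, hF, hFι⟩ := exists_continuous_extend_profinite hι hκ.index_open κ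
  obtain ⟨F', hF', hF'κ⟩ := exists_continuous_extend_profinite hκ hι.index_open ι
  have h1 : F'.comp F = MonoidHom.id P :=
    continuous_extend_profinite_unique hι (hF'.comp hF) continuous_id fun γ => by
      rw [MonoidHom.comp_apply, hFι, hF'κ, MonoidHom.id_apply]
  have h2 : F.comp F' = MonoidHom.id P' :=
    continuous_extend_profinite_unique hκ (hF.comp hF') continuous_id fun γ => by
      rw [MonoidHom.comp_apply, hF'κ, hFι, MonoidHom.id_apply]
  let e₀ : P ≃* P' :=
    MulEquiv.mk ⟨F, F', fun x => DFunLike.congr_fun h1 x, fun x => DFunLike.congr_fun h2 x⟩ F.map_mul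
  let e : P ≃ₜ* P' :=
    { e₀ with
      continuous_toFun := hF
      continuous_invFun := hF' }
  exact ⟨e, hFι⟩

omit [CompactSpace P'] [IsTopologicalGroup P] [CompactSpace P] [TotallyDisconnectedSpace P] in
/-- The isomorphism between two pro-`Σ` completions of `Γ` compatible with the structure maps is
unique. [cite: MochizukiSemiAnbd2006, Ex. 2.10 p.31] -/
theorem continuousMulEquiv_unique (hι : IsProSigmaCompletion Sigma ι) {κ : Γ →* P'}
    {e e' : P ≃ₜ* P'} (he : ∀ γ, e (ι γ) = κ γ) (he' : ∀ γ, e' (ι γ) = κ γ) : e = e' := by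
  have h : (e : P → P') = e' :=
    Continuous.ext_on hι.dense e.continuous e'.continuous (by
      rintro _ ⟨γ, rfl⟩
      exact (he γ).trans (he' γ).symm)
  exact ContinuousMulEquiv.ext fun x => congrFun h x

end Canonical

end Literature.AnabelianGeometry.SemiGraphs.SemiGraphOfAnabelioids.IsProSigmaCompletion
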